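import Literature.Analysis.FunctionSpaces.EhrlingLemma
import Mathlib.MeasureTheory.Function.ConvergenceInMeasure
import HarnessLib

/-!
# Strong `L²` compactness of space–time fields from slice-wise weak convergence and an
`L²_t H¹_x` bound (the Aubin–Lions / Rellich–Lions compactness step, via Ehrling's lemma)

Analysis/FunctionSpaces theorem file (no definitions, no named facts); sequel of `EhrlingLemma`.
It isolates, in a form directly usable for weak solutions of evolution PDE on cylinders
`I × Ω` (`I = (a, b)` a bounded time interval, `Ω` a bounded Lipschitz domain — e.g. a ball — of a
finite-dimensional real inner product space with Lebesgue measure, values in a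
finite-dimensional real normed space `F`), the classical **compactness theorem of Aubin–Lions
type** in the Hilbertian `L^∞_t L²_x ∩ L²_t H¹_x` setting of Hopf and Temam (R. Temam,
*Navier–Stokes equations* (1977/79), Ch. III, §2, Thm. 2.1; J.-L. Lions, *Quelques méthodes …*
(1969), Ch. 1, Thm. 5.1; E. Hopf 1951, §4; P. G. Lemarié-Rieusset, *The Navier–Stokes problem in
the 21st century* (2016), Thm. 12.1 "Rellich–Lions theorem"): it is the step "`v_k` bounded in
`L^∞(0,T;L²(B)) ∩ L²(0,T;H¹(B))` and `v_k(t) ⇀ v(t)` weakly for a.e. `t` ⟹ `v_k → v` strongly in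
`L²((0,T) × B)`" of every construction of weak solutions of the Navier–Stokes equations by
compactness (Leray–Hopf solutions; local Leray solutions, Lemarié-Rieusset 2016, Ch. 14 and
Kikuchi–Seregin 2007; the compactness of suitable weak solutions, Lin 1998, Thm. 2.2 and
Caffarelli–Kohn–Nirenberg 1982; discretely self-similar solutions, Bradshaw–Tsai 2017, §3 and
Bradshaw–Tsai 2019, §4.3 "As usual … `v_k` converges to `v` … in `L²(0,T;L²(B₁))`").

## Main results

For fields `v_k : I × Ω → F` (`k ∈ ℕ`), jointly a.e.-strongly measurable, with
(E) `∫_Ω ‖v_k(t)‖² ≤ C` for a.e. `t ∈ I`; (G) for a.e. `t` a weak derivative `G_k(t)` of the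
slice `v_k(t)` on `Ω` (tree notion `HasWeakFDerivOn`, e.g. the slices of a space–time weak
gradient, `FluidPDE/WeakGradientSlicing`), `G_k` jointly measurable, `∫_I∫_Ω ‖G_k‖² ≤ C_g`
(operator norm); (P) for every real test function `φ ∈ C_c^∞(Ω)`, convergence of the pairings
`∫_Ω φ • v_k(t)` for a.e. `t ∈ I`:

* `AubinLions.tendsto_lintegral_sub_sq_atTop_prod` — `(v_k)` is **Cauchy in `L²(I × Ω)`**;
* `AubinLions.exists_strong_limit` — there is a jointly measurable `u` with `∫_Ω ‖u(t)‖² ≤ C`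
  for a.e. `t`, `v_k → u` **strongly in `L²(I × Ω)`** (`∫_I∫_Ω ‖v_k - u‖² → 0`), and whose slice
  pairings are the limits in (P);
* `AubinLions.tendsto_lintegral_sub_sq_of_slice_pairings` — if the limits in (P) are the pairings
  of a given jointly measurable field `u` with `L²` slices (e.g. `v_k(t) ⇀ u(t)` weakly in
  `L²(Ω)` for a.e. `t`), then `∫_I∫_Ω ‖v_k - u‖² → 0`.

Supporting lemmas (namespace `AubinLions`): `lintegral_sub_sq_le` (Ehrling's inequality on a.e.
slice of `v₁ - v₂`, integrated in time), `tendsto_lintegral_pairing_sub` (dominated convergence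
of the pairing terms), `exists_subseq_ae_tendsto_slice` (`L²(I × Ω)` convergence gives `L²(Ω)`
convergence of a.e. slice along a subsequence), `tendsto_integral_smul_of_tendsto_lintegral`,
`ae_eq_of_ae_ae_slice`, and `L²`/Tonelli bookkeeping on `I × Ω`.

## Proof

Given `ε > 0`, Ehrling's lemma (`ehrling`, file `EhrlingLemma`) supplies test functions
`φ₁, …, φₙ` with `‖w‖²_{L²(Ω)} ≤ ε₁ (‖w‖² + ‖Dw‖²)_{L²(Ω)} + Σᵢ ‖∫_Ω φᵢ • w‖²` for all `w ∈ W^{1,2}`.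
Applied to `w = v_k(t) - v_l(t)` for a.e. `t` and integrated over `I`:
`∫_I∫_Ω ‖v_k - v_l‖² ≤ ε₁ (4C|I| + 4C_g) + Σᵢ ∫_I ‖∫_Ω φᵢ • v_k(t) - ∫_Ω φᵢ • v_l(t)‖² dt`, and
each of the finitely many pairing terms tends to `0` as `k, l → ∞` by (P), (E) and dominated
convergence (Temam, Ch. III, proof of Thm. 2.1, (2.34)–(2.40)). Completeness of `L²(I × Ω)`
gives the limit; its slices are identified along a subsequence converging in `L²(Ω)` for a.e.
`t` (`L¹`-convergence of the slice energies, convergence in measure, Brezis 2011, Thm. 4.9), and,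
for a prescribed `u`, by the separation lemma of `EhrlingLemma`. In the applications hypothesis
(P) is obtained from the equation (equicontinuity in `t` of the pairings, Arzelà–Ascoli and a
diagonal argument), exactly as in the cited proofs; it replaces the abstract bound on `∂ₜ v_k`.

## Mathlib / tree search

Mathlib (this pin) has the complete space `Lp F 2 μ` (`cauchySeq_tendsto_of_complete`,
`Lp.cauchySeq_Lp_iff_cauchySeq_eLpNorm`, `Lp.tendsto_Lp_iff_tendsto_eLpNorm'`), Tonelli
(`lintegral_prod`, `Measure.prod_restrict`), convergence in measure
(`tendstoInMeasure_of_tendsto_eLpNorm`, `TendstoInMeasure.exists_seq_tendsto_ae`) and dominated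
convergence for `lintegral`; it has no Aubin–Lions / Rellich–Lions / Ehrling type result
(searched `Aubin`, `Ehrling`, `Rellich`, `compact embedding`). The tree had weak sequential
compactness in Hilbert spaces (`FunctionSpaces/SpaceTimeWeakCompactness`, `DiagonalWeakLimits`),
Rellich–Kondrachov (`SobolevTraceRellichProofs`), slices of weak gradients
(`FluidPDE/WeakGradientSlicing`) and Leray's whole-space compactness argument
(`FluidPDE/NSLerayRegularisedLimit`, which relies on the energy equality of smooth
approximants), but no strong space–time compactness theorem on cylinders (searched
`compactness`, `Aubin`, `strong` in `Literature/Analysis`).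

## References

* R. Temam, *Navier–Stokes equations. Theory and numerical analysis* (North-Holland, 1977;
  rev. ed. 1979), Ch. III, §2, Lemma 2.1 and Thm. 2.1. [Temam1979]
* P. G. Lemarié-Rieusset, *The Navier–Stokes problem in the 21st century* (CRC, 2016), §12.1,
  Thm. 12.1 (Rellich–Lions), p. 355. [Lemarierieusset2016]
* J.-L. Lions, *Quelques méthodes de résolution des problèmes aux limites non linéaires*
  (Dunod, 1969), Ch. 1, §5, Lemme 5.1, Thm. 5.1.
* E. Hopf, *Über die Anfangswertaufgabe für die hydrodynamischen Grundgleichungen*,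
  Math. Nachr. 4 (1951), 213–231, §4.
* H. Brezis, *Functional Analysis, Sobolev Spaces and PDE* (Springer, 2011), Thm. 4.9. [Brezis2011]
* Z. Bradshaw, T.-P. Tsai, Analysis & PDE 12 (2019) = arXiv:1801.08060, §4.3. [BradshawTsai2019]
-/

noncomputable section

open MeasureTheory TopologicalSpace Set Function Filter Topology Metric Bornology
open scoped ENNReal NNReal

namespace Literature.Analysis.FunctionSpaces

/-! ### `L²` bookkeeping -/

section LTwo

variable {α : Type*} [MeasurableSpace α]
variable {F : Type*} [NormedAddCommGroup F]

/-- `‖f‖²_{L²(μ)} = ∫ ‖f‖²` in `ℝ≥0∞`. [folklore] -/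
theorem AubinLions.eLpNorm_two_sq (f : α → F) (μ : Measure α) :
    eLpNorm f 2 μ ^ 2 = ∫⁻ x, ‖f x‖ₑ ^ 2 ∂μ := by
  have h2 : (2 : ℝ≥0∞).toReal = 2 := by norm_num
  rw [eLpNorm_eq_lintegral_rpow_enorm_toReal two_ne_zero ENNReal.ofNat_ne_top, h2,
    ← ENNReal.rpow_natCast, ← ENNReal.rpow_mul]
  norm_num

/-- `‖f‖_{L²(μ)} = (∫ ‖f‖²)^{1/2}` in `ℝ≥0∞`. [folklore] -/
theorem AubinLions.eLpNorm_two_eq_rpow (f : α → F) (μ : Measure α) :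
    eLpNorm f 2 μ = (∫⁻ x, ‖f x‖ₑ ^ 2 ∂μ) ^ (1 / 2 : ℝ) := by
  rw [← AubinLions.eLpNorm_two_sq, ← ENNReal.rpow_natCast, ← ENNReal.rpow_mul]
  norm_num

/-- `‖x - y‖² ≤ 2 (‖x‖² + ‖y‖²)` for the extended norm (`(p + q)² ≤ 2 (p² + q²)`, cf. the
tree's `FourierProductLaw.ennreal_add_sq_le_two_mul`). [folklore] -/
theorem AubinLions.enorm_sub_sq_le (x y : F) : ‖x - y‖ₑ ^ 2 ≤ 2 * (‖x‖ₑ ^ 2 + ‖y‖ₑ ^ 2) := by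
  have h := ENNReal.rpow_add_le_mul_rpow_add_rpow ‖x‖ₑ ‖y‖ₑ (p := 2) (by norm_num)
  norm_num at h
  have h' : (‖x‖ₑ + ‖y‖ₑ) ^ 2 ≤ 2 * (‖x‖ₑ ^ 2 + ‖y‖ₑ ^ 2) := by exact_mod_cast h
  exact (pow_le_pow_left' enorm_sub_le 2).trans h'

end LTwo

/-! ### Slices of space–time fields on `I × O` -/

section Slices

variable {Y : Type*} [MeasureSpace Y] [SFinite (volume : Measure Y)]
variable {F : Type*} [NormedAddCommGroup F]
variable {I : Set ℝ} {O : Set Y}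

/-- The restricted product measure is the product of the restrictions. [folklore] -/
theorem AubinLions.volume_restrict_prod (I : Set ℝ) (O : Set Y) :
    (volume : Measure (ℝ × Y)).restrict (I ×ˢ O) =
      ((volume : Measure ℝ).restrict I).prod ((volume : Measure Y).restrict O) := by
  rw [Measure.volume_eq_prod, Measure.prod_restrict]

/-- A.e. slice of a jointly a.e.-strongly measurable field is a.e.-strongly measurable.
[folklore] -/
theorem AubinLions.ae_aestronglyMeasurable_slice {f : ℝ × Y → F}
    (hf : AEStronglyMeasurable f (volume.restrict (I ×ˢ O))) :
    ∀ᵐ t ∂(volume.restrict I), AEStronglyMeasurable (fun y => f (t, y)) (volume.restrict O) := by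
  rw [AubinLions.volume_restrict_prod] at hf
  exact hf.prodMk_left

/-- Measurability in time of the slice energies `t ↦ ∫_O ‖f(t, ·)‖²`. [folklore] -/
theorem AubinLions.aemeasurable_lintegral_slice {f : ℝ × Y → F}
    (hf : AEStronglyMeasurable f (volume.restrict (I ×ˢ O))) :
    AEMeasurable (fun t => ∫⁻ y in O, ‖f (t, y)‖ₑ ^ 2) (volume.restrict I) := by
  rw [AubinLions.volume_restrict_prod] at hf
  exact (hf.enorm.pow_const 2).lintegral_prod_right'

/-- Tonelli on `I × O` for `‖f‖²`. [folklore] -/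
theorem AubinLions.lintegral_sq_eq_lintegral_slice {f : ℝ × Y → F}
    (hf : AEStronglyMeasurable f (volume.restrict (I ×ˢ O))) :
    ∫⁻ z in I ×ˢ O, ‖f z‖ₑ ^ 2 = ∫⁻ t in I, ∫⁻ y in O, ‖f (t, y)‖ₑ ^ 2 := by
  rw [AubinLions.volume_restrict_prod] at hf ⊢
  exact lintegral_prod _ (hf.enorm.pow_const 2)

/-- Measurability in time of the slice pairings `t ↦ ∫_O φ • f(t, ·)`. [folklore] -/
theorem AubinLions.aestronglyMeasurable_integral_smul_slice [NormedSpace ℝ F] {f : ℝ × Y → F}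
    (hf : AEStronglyMeasurable f (volume.restrict (I ×ˢ O))) {φ : Y → ℝ}
    (hφ : AEStronglyMeasurable φ (volume.restrict O)) :
    AEStronglyMeasurable (fun t => ∫ y in O, φ y • f (t, y)) (volume.restrict I) := by
  rw [AubinLions.volume_restrict_prod] at hf
  have h : AEStronglyMeasurable (fun z : ℝ × Y => φ z.2 • f z)
      (((volume : Measure ℝ).restrict I).prod ((volume : Measure Y).restrict O)) :=
    (hφ.comp_snd (μ := (volume : Measure ℝ).restrict I)).smul hf
  exact h.integral_prod_right'

/-- Slices of an `L²(I × O)` field are in `L²(O)` for a.e. time. [folklore] -/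
theorem AubinLions.ae_lintegral_slice_lt_top {f : ℝ × Y → F}
    (hf : AEStronglyMeasurable f (volume.restrict (I ×ˢ O)))
    (hfin : ∫⁻ z in I ×ˢ O, ‖f z‖ₑ ^ 2 ≠ ⊤) :
    ∀ᵐ t ∂(volume.restrict I), ∫⁻ y in O, ‖f (t, y)‖ₑ ^ 2 < ⊤ := by
  rw [AubinLions.lintegral_sq_eq_lintegral_slice hf] at hfin
  exact ae_lt_top' (AubinLions.aemeasurable_lintegral_slice hf) hfin

/-- **Two fields agreeing slice-wise a.e. agree a.e. on the product.** [folklore] -/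
theorem AubinLions.ae_eq_of_ae_ae_slice {f g : ℝ × Y → F}
    (hf : AEStronglyMeasurable f (volume.restrict (I ×ˢ O)))
    (hg : AEStronglyMeasurable g (volume.restrict (I ×ˢ O)))
    (h : ∀ᵐ t ∂(volume.restrict I), ∀ᵐ y ∂(volume.restrict O), f (t, y) = g (t, y)) :
    f =ᵐ[volume.restrict (I ×ˢ O)] g := by
  rw [AubinLions.volume_restrict_prod] at hf hg ⊢
  have h1 : ∀ᵐ t ∂(volume.restrict I), ∀ᵐ y ∂(volume.restrict O), f (t, y) = hf.mk f (t, y) :=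
    Measure.ae_ae_of_ae_prod hf.ae_eq_mk
  have h2 : ∀ᵐ t ∂(volume.restrict I), ∀ᵐ y ∂(volume.restrict O), g (t, y) = hg.mk g (t, y) :=
    Measure.ae_ae_of_ae_prod hg.ae_eq_mk
  have hS : MeasurableSet {z : ℝ × Y | hf.mk f z = hg.mk g z} :=
    hf.stronglyMeasurable_mk.measurableSet_eq_fun hg.stronglyMeasurable_mk
  have h3 : ∀ᵐ z ∂((volume : Measure ℝ).restrict I).prod ((volume : Measure Y).restrict O),
      hf.mk f z = hg.mk g z := by
    rw [Measure.ae_prod_iff_ae_ae hS]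
    filter_upwards [h, h1, h2] with t ht ht1 ht2
    filter_upwards [ht, ht1, ht2] with y hy hy1 hy2
    rw [← hy1, ← hy2, hy]
  filter_upwards [hf.ae_eq_mk, hg.ae_eq_mk, h3] with z hz1 hz2 hz3
  rw [hz1, hz2, hz3]

end Slices

/-! ### From `L²(I × O)` convergence to slice convergence along a subsequence -/

section SliceSubseq

variable {Y : Type*} [MeasureSpace Y] [SFinite (volume : Measure Y)]
variable {F : Type*} [NormedAddCommGroup F]
variable {I : Set ℝ} {O : Set Y}

/-- **Slice convergence along a subsequence.** If `f_k → g` in `L²(I × O)` (`∫∫ ‖f_k - g‖² → 0`,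
all fields jointly a.e.-strongly measurable with `∫∫ ‖f_k - g‖² < ∞`), then along a subsequence
`σ` the slices converge in `L²(O)` for a.e. `t ∈ I`: `∫_O ‖f_{σ j}(t) - g(t)‖² → 0`
(the slice energies converge to `0` in `L¹(I)`, hence in measure, hence a.e. along a
subsequence; Brezis 2011, Thm. 4.9). [folklore] -/
theorem AubinLions.exists_subseq_ae_tendsto_slice {f : ℕ → ℝ × Y → F} {g : ℝ × Y → F}
    (hf : ∀ k, AEStronglyMeasurable (f k) (volume.restrict (I ×ˢ O)))
    (hg : AEStronglyMeasurable g (volume.restrict (I ×ˢ O)))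
    (hfin : ∀ k, ∫⁻ z in I ×ˢ O, ‖f k z - g z‖ₑ ^ 2 ≠ ⊤)
    (h : Tendsto (fun k => ∫⁻ z in I ×ˢ O, ‖f k z - g z‖ₑ ^ 2) atTop (𝓝 0)) :
    ∃ σ : ℕ → ℕ, StrictMono σ ∧ ∀ᵐ t ∂(volume.restrict I),
      Tendsto (fun j => ∫⁻ y in O, ‖f (σ j) (t, y) - g (t, y)‖ₑ ^ 2) atTop (𝓝 0) := by
  -- the slice energies `H k t = ∫_O ‖f_k(t) - g(t)‖²`
  have hHm : ∀ k, AEMeasurable (fun t => ∫⁻ y in O, ‖(f k - g) (t, y)‖ₑ ^ 2) (volume.restrict I) :=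
    fun k => AubinLions.aemeasurable_lintegral_slice ((hf k).sub hg)
  have hHI : ∀ k, ∫⁻ z in I ×ˢ O, ‖f k z - g z‖ₑ ^ 2 =
      ∫⁻ t in I, ∫⁻ y in O, ‖(f k - g) (t, y)‖ₑ ^ 2 := fun k =>
    AubinLions.lintegral_sq_eq_lintegral_slice ((hf k).sub hg)
  have hHfin : ∀ᵐ t ∂(volume.restrict I), ∀ k, ∫⁻ y in O, ‖(f k - g) (t, y)‖ₑ ^ 2 < ⊤ :=
    ae_all_iff.2 fun k => ae_lt_top' (hHm k) ((hHI k) ▸ hfin k)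
  -- the real-valued slice energies converge to `0` in `L¹(I)`
  have hRm : ∀ k, AEStronglyMeasurable (fun t => (∫⁻ y in O, ‖(f k - g) (t, y)‖ₑ ^ 2).toReal)
      (volume.restrict I) := fun k => (hHm k).ennreal_toReal.aestronglyMeasurable
  have hR1 : Tendsto (fun k => eLpNorm ((fun t => (∫⁻ y in O, ‖(f k - g) (t, y)‖ₑ ^ 2).toReal) - 0)
      1 (volume.restrict I)) atTop (𝓝 0) := by
    refine tendsto_of_tendsto_of_tendsto_of_le_of_le tendsto_const_nhds h
      (fun k => zero_le) fun k => ?_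
    rw [sub_zero, eLpNorm_one_eq_lintegral_enorm, hHI]
    refine lintegral_mono fun t => ?_
    rw [Real.enorm_eq_ofReal ENNReal.toReal_nonneg]
    exact ENNReal.ofReal_toReal_le
  have hmeas : TendstoInMeasure (volume.restrict I)
      (fun k t => (∫⁻ y in O, ‖(f k - g) (t, y)‖ₑ ^ 2).toReal) atTop 0 :=
    tendstoInMeasure_of_tendsto_eLpNorm one_ne_zero hRm aestronglyMeasurable_const hR1
  obtain ⟨σ, hσ, hae⟩ := hmeas.exists_seq_tendsto_ae
  refine ⟨σ, hσ, ?_⟩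
  filter_upwards [hae, hHfin] with t ht htfin
  have h1 : Tendsto (fun j => ENNReal.ofReal ((∫⁻ y in O, ‖(f (σ j) - g) (t, y)‖ₑ ^ 2).toReal))
      atTop (𝓝 0) := by
    have h2 := (ENNReal.continuous_ofReal.tendsto 0).comp ht
    rw [ENNReal.ofReal_zero] at h2
    exact h2
  refine h1.congr fun j => ?_
  rw [ENNReal.ofReal_toReal (htfin (σ j)).ne]
  rfl

omit [SFinite (volume : Measure Y)] in
/-- **Pairings converge along slice convergence.** If `∫_O ‖w_j - w_∞‖² → 0` then
`∫_O φ • w_j → ∫_O φ • w_∞` for every `φ ∈ L²(O)` (Cauchy–Schwarz). [folklore] -/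
theorem AubinLions.tendsto_integral_smul_of_tendsto_lintegral [NormedSpace ℝ F]
    {w : ℕ → Y → F} {w' : Y → F} {φ : Y → ℝ}
    (hw : ∀ j, AEStronglyMeasurable (w j) (volume.restrict O))
    (hw' : AEStronglyMeasurable w' (volume.restrict O))
    (hφ : MemLp φ 2 (volume.restrict O))
    (hint : ∀ j, Integrable (fun y => φ y • w j y) (volume.restrict O))
    (hint' : Integrable (fun y => φ y • w' y) (volume.restrict O))
    (h : Tendsto (fun j => ∫⁻ y in O, ‖w j y - w' y‖ₑ ^ 2) atTop (𝓝 0)) :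
    Tendsto (fun j => ∫ y in O, φ y • w j y) atTop (𝓝 (∫ y in O, φ y • w' y)) := by
  rw [tendsto_iff_edist_tendsto_0]
  have hb : ∀ j, edist (∫ y in O, φ y • w j y) (∫ y in O, φ y • w' y) ≤
      eLpNorm φ 2 (volume.restrict O) * (∫⁻ y in O, ‖w j y - w' y‖ₑ ^ 2) ^ (1 / 2 : ℝ) := by
    intro j
    rw [edist_eq_enorm_sub, ← integral_sub (hint j) hint']
    have e : (fun y => φ y • w j y - φ y • w' y) = fun y => φ y • (w j y - w' y) := by
      funext y; rw [smul_sub]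
    rw [e, ← AubinLions.eLpNorm_two_eq_rpow]
    exact Ehrling.enorm_integral_smul_le hφ.1 ((hw j).sub hw')
  have h0 : Tendsto (fun j => eLpNorm φ 2 (volume.restrict O) *
      (∫⁻ y in O, ‖w j y - w' y‖ₑ ^ 2) ^ (1 / 2 : ℝ)) atTop (𝓝 0) := by
    have h1 : Tendsto (fun j => (∫⁻ y in O, ‖w j y - w' y‖ₑ ^ 2) ^ (1 / 2 : ℝ)) atTop (𝓝 0) := by
      have h2 := ((ENNReal.continuous_rpow_const (y := (1 / 2 : ℝ))).tendsto (0 : ℝ≥0∞)).comp h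
      rw [ENNReal.zero_rpow_of_pos (by norm_num : (0 : ℝ) < 1 / 2)] at h2
      exact h2
    simpa using ENNReal.Tendsto.const_mul h1 (Or.inr hφ.eLpNorm_ne_top)
  exact tendsto_of_tendsto_of_tendsto_of_le_of_le tendsto_const_nhds h0 (fun j => zero_le) hb

end SliceSubseq

/-! ### The compactness theorem -/

section Main

variable {E' : Type*} [NormedAddCommGroup E'] [InnerProductSpace ℝ E'] [FiniteDimensional ℝ E']
  [MeasureSpace E'] [BorelSpace E'] [(volume : Measure E').IsAddHaarMeasure]
variable {F : Type*} [NormedAddCommGroup F] [NormedSpace ℝ F] [FiniteDimensional ℝ F]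

omit [FiniteDimensional ℝ F] in
/-- **Dominated convergence for the slice pairings.** If the slices of the fields `v_k` on
`I × Ω` have `∫_Ω ‖v_k(t)‖² ≤ C` for a.e. `t` and the pairings `∫_Ω φ • v_k(t)` with a test
function `φ` converge for a.e. `t` to `L(t)`, then `∫_I ‖∫_Ω φ • v_k(t) - L(t)‖² dt → 0`.
[folklore] -/
theorem AubinLions.tendsto_lintegral_pairing_sub {Ω : Opens E'} {a b : ℝ}
    {v : ℕ → ℝ → E' → F} {C : ℝ≥0∞} (hC : C ≠ ⊤)
    (hvm : ∀ k, AEStronglyMeasurable (uncurry (v k)) (volume.restrict (Ioo a b ×ˢ (Ω : Set E'))))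
    (hvE : ∀ k, ∀ᵐ t ∂(volume.restrict (Ioo a b)), ∫⁻ x in (Ω : Set E'), ‖v k t x‖ₑ ^ 2 ≤ C)
    {φ : E' → ℝ} (hφ : IsTestFunctionOn Ω φ) {L : ℝ → F}
    (hL : ∀ᵐ t ∂(volume.restrict (Ioo a b)),
      Tendsto (fun k => ∫ x in (Ω : Set E'), φ x • v k t x) atTop (𝓝 (L t))) :
    Tendsto (fun k => ∫⁻ t in Ioo a b, ‖(∫ x in (Ω : Set E'), φ x • v k t x) - L t‖ₑ ^ 2)
      atTop (𝓝 0) := by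
  haveI : IsFiniteMeasure ((volume : Measure ℝ).restrict (Ioo a b)) :=
    ⟨by rw [Measure.restrict_apply_univ]; exact measure_Ioo_lt_top⟩
  have hKt : eLpNorm φ 2 (volume.restrict (Ω : Set E')) ≠ ⊤ :=
    ((Ehrling.memLp_two_of_isTestFunctionOn hφ volume).restrict _).eLpNorm_ne_top
  have hφm : AEStronglyMeasurable φ (volume.restrict (Ω : Set E')) :=
    hφ.contDiff.continuous.aestronglyMeasurable
  -- measurability of the pairings and of the limit
  have hPm : ∀ k, AEStronglyMeasurable (fun t => ∫ x in (Ω : Set E'), φ x • v k t x)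
      (volume.restrict (Ioo a b)) :=
    fun k => AubinLions.aestronglyMeasurable_integral_smul_slice (hvm k) hφm
  have hLm : AEStronglyMeasurable L (volume.restrict (Ioo a b)) :=
    aestronglyMeasurable_of_tendsto_ae atTop hPm hL
  -- uniform bound of the pairings and of the limit
  have hslice : ∀ k, ∀ᵐ t ∂(volume.restrict (Ioo a b)),
      AEStronglyMeasurable (v k t) (volume.restrict (Ω : Set E')) := fun k =>
    AubinLions.ae_aestronglyMeasurable_slice (hvm k)
  have hPb : ∀ᵐ t ∂(volume.restrict (Ioo a b)), ∀ k,
      ‖∫ x in (Ω : Set E'), φ x • v k t x‖ₑ ^ 2 ≤ eLpNorm φ 2 (volume.restrict (Ω : Set E')) ^ 2 * C := by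
    rw [ae_all_iff]
    intro k
    filter_upwards [hvE k, hslice k] with t ht hts
    calc ‖∫ x in (Ω : Set E'), φ x • v k t x‖ₑ ^ 2
        ≤ (eLpNorm φ 2 (volume.restrict (Ω : Set E')) *
            eLpNorm (v k t) 2 (volume.restrict (Ω : Set E'))) ^ 2 :=
          pow_le_pow_left' (Ehrling.enorm_integral_smul_le hφm hts) 2
      _ = eLpNorm φ 2 (volume.restrict (Ω : Set E')) ^ 2 * ∫⁻ x in (Ω : Set E'), ‖v k t x‖ₑ ^ 2 := by
          rw [mul_pow, AubinLions.eLpNorm_two_sq (v k t)]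
      _ ≤ eLpNorm φ 2 (volume.restrict (Ω : Set E')) ^ 2 * C := mul_le_mul' le_rfl ht
  have hLb : ∀ᵐ t ∂(volume.restrict (Ioo a b)),
      ‖L t‖ₑ ^ 2 ≤ eLpNorm φ 2 (volume.restrict (Ω : Set E')) ^ 2 * C := by
    filter_upwards [hPb, hL] with t ht htL
    have hT : Tendsto (fun k => ‖∫ x in (Ω : Set E'), φ x • v k t x‖ₑ ^ 2) atTop
        (𝓝 (‖L t‖ₑ ^ 2)) :=
      ((ENNReal.continuous_pow 2).tendsto _).comp ((continuous_enorm.tendsto _).comp htL)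
    exact le_of_tendsto' hT ht
  -- dominated convergence
  have hF : ∀ k, AEMeasurable (fun t => ‖(∫ x in (Ω : Set E'), φ x • v k t x) - L t‖ₑ ^ 2)
      (volume.restrict (Ioo a b)) :=
    fun k => ((hPm k).sub hLm).enorm.pow_const 2
  have hbound : ∀ k, ∀ᵐ t ∂(volume.restrict (Ioo a b)),
      ‖(∫ x in (Ω : Set E'), φ x • v k t x) - L t‖ₑ ^ 2 ≤
      2 * (eLpNorm φ 2 (volume.restrict (Ω : Set E')) ^ 2 * C +
        eLpNorm φ 2 (volume.restrict (Ω : Set E')) ^ 2 * C) := by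
    intro k
    filter_upwards [hPb, hLb] with t ht htL
    exact (AubinLions.enorm_sub_sq_le _ _).trans (mul_le_mul' le_rfl (add_le_add (ht k) htL))
  have hfin : ∫⁻ _ in Ioo a b, 2 * (eLpNorm φ 2 (volume.restrict (Ω : Set E')) ^ 2 * C +
      eLpNorm φ 2 (volume.restrict (Ω : Set E')) ^ 2 * C) ≠ ⊤ := by
    rw [lintegral_const]
    refine ENNReal.mul_ne_top ?_ (measure_ne_top _ _)
    have : eLpNorm φ 2 (volume.restrict (Ω : Set E')) ^ 2 * C ≠ ⊤ :=
      ENNReal.mul_ne_top (ENNReal.pow_ne_top hKt) hC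
    exact ENNReal.mul_ne_top (by simp) (ENNReal.add_ne_top.2 ⟨this, this⟩)
  have hlim : ∀ᵐ t ∂(volume.restrict (Ioo a b)),
      Tendsto (fun k => ‖(∫ x in (Ω : Set E'), φ x • v k t x) - L t‖ₑ ^ 2) atTop (𝓝 0) := by
    filter_upwards [hL] with t ht
    have h1 : Tendsto (fun k => (∫ x in (Ω : Set E'), φ x • v k t x) - L t) atTop (𝓝 0) :=
      tendsto_sub_nhds_zero_iff.2 ht
    have h2 : Tendsto (fun k => ‖(∫ x in (Ω : Set E'), φ x • v k t x) - L t‖ₑ ^ 2) atTop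
        (𝓝 (‖(0 : F)‖ₑ ^ 2)) :=
      ((ENNReal.continuous_pow 2).tendsto _).comp ((continuous_enorm.tendsto _).comp h1)
    rw [enorm_zero, zero_pow two_ne_zero] at h2
    exact h2
  have := tendsto_lintegral_of_dominated_convergence' _ hF hbound hfin hlim
  rw [lintegral_zero] at this
  exact this

omit [FiniteDimensional ℝ F] in
/-- **The integrated Ehrling estimate for a pair of fields.** Let `v₁, v₂` be jointly measurable
fields on `I × Ω` (`I = (a, b)`) with `∫_Ω ‖vⱼ(t)‖² ≤ C` for a.e. `t`, slice-wise weak derivatives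
`Gⱼ(t)` for a.e. `t` (jointly measurable) with `∫_I ∫_Ω ‖Gⱼ‖² ≤ C_g`, and let `φ₁, …, φₙ` be test
functions satisfying Ehrling's inequality at level `ε₁` (the conclusion of `ehrling`). Then for
any functions `Lᵢ : I → F` (measurable in time),
`∫_I ∫_Ω ‖v₁ - v₂‖² ≤ ε₁ (4 C |I| + 4 C_g) + Σᵢ 2 (Dᵢ(v₁) + Dᵢ(v₂))`,
`Dᵢ(v) = ∫_I ‖∫_Ω φᵢ • v(t) - Lᵢ(t)‖² dt` (Ehrling's inequality on a.e. slice, integrated in time;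
Temam 1977/79, Ch. III, proof of Thm. 2.1). [cite: Temam1979, Ch. III §2 Thm. 2.1 (proof)] -/
theorem AubinLions.lintegral_sub_sq_le {Ω : Opens E'} (hbΩ : IsBounded (Ω : Set E')) {a b : ℝ}
    {v₁ v₂ : ℝ → E' → F} {G₁ G₂ : ℝ → E' → E' →L[ℝ] F} {C Cg : ℝ≥0∞} (hC : C ≠ ⊤)
    (hm₁ : AEStronglyMeasurable (uncurry v₁) (volume.restrict (Ioo a b ×ˢ (Ω : Set E'))))
    (hm₂ : AEStronglyMeasurable (uncurry v₂) (volume.restrict (Ioo a b ×ˢ (Ω : Set E'))))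
    (hE₁ : ∀ᵐ t ∂(volume.restrict (Ioo a b)), ∫⁻ x in (Ω : Set E'), ‖v₁ t x‖ₑ ^ 2 ≤ C)
    (hE₂ : ∀ᵐ t ∂(volume.restrict (Ioo a b)), ∫⁻ x in (Ω : Set E'), ‖v₂ t x‖ₑ ^ 2 ≤ C)
    (hGm₁ : AEStronglyMeasurable (uncurry G₁) (volume.restrict (Ioo a b ×ˢ (Ω : Set E'))))
    (hGm₂ : AEStronglyMeasurable (uncurry G₂) (volume.restrict (Ioo a b ×ˢ (Ω : Set E'))))
    (hw₁ : ∀ᵐ t ∂(volume.restrict (Ioo a b)), HasWeakFDerivOn Ω volume (v₁ t) (G₁ t))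
    (hw₂ : ∀ᵐ t ∂(volume.restrict (Ioo a b)), HasWeakFDerivOn Ω volume (v₂ t) (G₂ t))
    (hGb₁ : ∫⁻ z in Ioo a b ×ˢ (Ω : Set E'), ‖G₁ z.1 z.2‖ₑ ^ 2 ≤ Cg)
    (hGb₂ : ∫⁻ z in Ioo a b ×ˢ (Ω : Set E'), ‖G₂ z.1 z.2‖ₑ ^ 2 ≤ Cg)
    {ε₁ : ℝ≥0∞} {n : ℕ} {φ : Fin n → E' → ℝ} (hφ : ∀ i, IsTestFunctionOn Ω (φ i))
    (hEhr : ∀ (w : E' → F) (g : E' → E' →L[ℝ] F), HasWeakFDerivOn Ω volume w g →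
      eLpNorm w 2 (volume.restrict (Ω : Set E')) ^ 2 ≤
        ε₁ * (eLpNorm w 2 (volume.restrict (Ω : Set E')) ^ 2 +
          eLpNorm g 2 (volume.restrict (Ω : Set E')) ^ 2) +
          ∑ i, ‖∫ x in (Ω : Set E'), φ i x • w x‖ₑ ^ 2)
    {L : Fin n → ℝ → F} (hLm : ∀ i, AEStronglyMeasurable (L i) (volume.restrict (Ioo a b))) :
    ∫⁻ z in Ioo a b ×ˢ (Ω : Set E'), ‖v₁ z.1 z.2 - v₂ z.1 z.2‖ₑ ^ 2 ≤
      ε₁ * (4 * C * volume (Ioo a b) + 4 * Cg) +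
        ∑ i, 2 * ((∫⁻ t in Ioo a b, ‖(∫ x in (Ω : Set E'), φ i x • v₁ t x) - L i t‖ₑ ^ 2) +
          ∫⁻ t in Ioo a b, ‖(∫ x in (Ω : Set E'), φ i x • v₂ t x) - L i t‖ₑ ^ 2) := by
  haveI : IsFiniteMeasure ((volume : Measure E').restrict (Ω : Set E')) := ⟨by
    rw [Measure.restrict_apply_univ]
    exact (measure_mono subset_closure).trans_lt hbΩ.isCompact_closure.measure_lt_top⟩
  -- measurability bookkeeping
  have hwm : AEStronglyMeasurable (uncurry v₁ - uncurry v₂)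
      (volume.restrict (Ioo a b ×ˢ (Ω : Set E'))) := hm₁.sub hm₂
  have hgm : AEStronglyMeasurable (uncurry G₁ - uncurry G₂)
      (volume.restrict (Ioo a b ×ˢ (Ω : Set E'))) := hGm₁.sub hGm₂
  have hs₁ : ∀ᵐ t ∂(volume.restrict (Ioo a b)),
      AEStronglyMeasurable (v₁ t) (volume.restrict (Ω : Set E')) :=
    AubinLions.ae_aestronglyMeasurable_slice hm₁
  have hs₂ : ∀ᵐ t ∂(volume.restrict (Ioo a b)),
      AEStronglyMeasurable (v₂ t) (volume.restrict (Ω : Set E')) :=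
    AubinLions.ae_aestronglyMeasurable_slice hm₂
  have hφm : ∀ i, AEStronglyMeasurable (φ i) (volume.restrict (Ω : Set E')) := fun i =>
    (hφ i).contDiff.continuous.aestronglyMeasurable
  have hPm₁ : ∀ i, AEStronglyMeasurable (fun t => ∫ x in (Ω : Set E'), φ i x • v₁ t x)
      (volume.restrict (Ioo a b)) :=
    fun i => AubinLions.aestronglyMeasurable_integral_smul_slice hm₁ (hφm i)
  have hPm₂ : ∀ i, AEStronglyMeasurable (fun t => ∫ x in (Ω : Set E'), φ i x • v₂ t x)
      (volume.restrict (Ioo a b)) :=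
    fun i => AubinLions.aestronglyMeasurable_integral_smul_slice hm₂ (hφm i)
  -- (1) the slice inequality, a.e. in time
  have hS4 : ∀ᵐ t ∂(volume.restrict (Ioo a b)),
      ∫⁻ x in (Ω : Set E'), ‖v₁ t x - v₂ t x‖ₑ ^ 2 ≤ 4 * C := by
    filter_upwards [hE₁, hE₂, hs₁, hs₂] with t h₁ h₂ h₁m h₂m
    calc ∫⁻ x in (Ω : Set E'), ‖v₁ t x - v₂ t x‖ₑ ^ 2
        ≤ ∫⁻ x in (Ω : Set E'), 2 * (‖v₁ t x‖ₑ ^ 2 + ‖v₂ t x‖ₑ ^ 2) :=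
          lintegral_mono fun x => AubinLions.enorm_sub_sq_le _ _
      _ = 2 * ((∫⁻ x in (Ω : Set E'), ‖v₁ t x‖ₑ ^ 2) + ∫⁻ x in (Ω : Set E'), ‖v₂ t x‖ₑ ^ 2) := by
          rw [lintegral_const_mul' _ _ ENNReal.ofNat_ne_top,
            lintegral_add_left' (h₁m.enorm.pow_const 2)]
      _ ≤ 2 * (C + C) := mul_le_mul' le_rfl (add_le_add h₁ h₂)
      _ = 4 * C := by ring
  have hineq : ∀ᵐ t ∂(volume.restrict (Ioo a b)),
      ∫⁻ x in (Ω : Set E'), ‖v₁ t x - v₂ t x‖ₑ ^ 2 ≤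
        ε₁ * (4 * C) + ε₁ * (∫⁻ x in (Ω : Set E'), ‖G₁ t x - G₂ t x‖ₑ ^ 2) +
          ∑ i, ‖(∫ x in (Ω : Set E'), φ i x • v₁ t x) -
            ∫ x in (Ω : Set E'), φ i x • v₂ t x‖ₑ ^ 2 := by
    filter_upwards [hw₁, hw₂, hS4, hs₁, hs₂, hE₁, hE₂] with t h₁ h₂ h4 h₁m h₂m hE₁t hE₂t
    have hw : HasWeakFDerivOn Ω volume (v₁ t - v₂ t) (G₁ t - G₂ t) := h₁.sub h₂
    have key := hEhr (v₁ t - v₂ t) (G₁ t - G₂ t) hw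
    rw [AubinLions.eLpNorm_two_sq (v₁ t - v₂ t), AubinLions.eLpNorm_two_sq (G₁ t - G₂ t)] at key
    -- integrability of the pairings, to split the integral of the difference
    have hmk : MemLp (v₁ t) 2 (volume.restrict (Ω : Set E')) := by
      refine ⟨h₁m, ?_⟩
      rw [AubinLions.eLpNorm_two_eq_rpow]
      exact ENNReal.rpow_lt_top_of_nonneg (by norm_num) (hE₁t.trans_lt hC.lt_top).ne
    have hml : MemLp (v₂ t) 2 (volume.restrict (Ω : Set E')) := by
      refine ⟨h₂m, ?_⟩
      rw [AubinLions.eLpNorm_two_eq_rpow]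
      exact ENNReal.rpow_lt_top_of_nonneg (by norm_num) (hE₂t.trans_lt hC.lt_top).ne
    have hpair : ∀ i, ∫ x in (Ω : Set E'), φ i x • (v₁ t - v₂ t) x =
        (∫ x in (Ω : Set E'), φ i x • v₁ t x) - ∫ x in (Ω : Set E'), φ i x • v₂ t x := by
      intro i
      rw [← integral_sub (Ehrling.integrable_smul_of_memLp_two (hφ i) hmk)
        (Ehrling.integrable_smul_of_memLp_two (hφ i) hml)]
      refine integral_congr_ae (Eventually.of_forall fun x => ?_)
      simp only [Pi.sub_apply, smul_sub]
    simp only [hpair] at key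
    calc ∫⁻ x in (Ω : Set E'), ‖v₁ t x - v₂ t x‖ₑ ^ 2
        = ∫⁻ x in (Ω : Set E'), ‖(v₁ t - v₂ t) x‖ₑ ^ 2 := by simp only [Pi.sub_apply]
      _ ≤ ε₁ * ((∫⁻ x in (Ω : Set E'), ‖(v₁ t - v₂ t) x‖ₑ ^ 2) +
            ∫⁻ x in (Ω : Set E'), ‖(G₁ t - G₂ t) x‖ₑ ^ 2) +
          ∑ i, ‖(∫ x in (Ω : Set E'), φ i x • v₁ t x) - ∫ x in (Ω : Set E'), φ i x • v₂ t x‖ₑ ^ 2 :=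
          key
      _ ≤ ε₁ * (4 * C + ∫⁻ x in (Ω : Set E'), ‖(G₁ t - G₂ t) x‖ₑ ^ 2) +
          ∑ i, ‖(∫ x in (Ω : Set E'), φ i x • v₁ t x) - ∫ x in (Ω : Set E'), φ i x • v₂ t x‖ₑ ^ 2 := by
          gcongr
          exact h4
      _ = ε₁ * (4 * C) + ε₁ * (∫⁻ x in (Ω : Set E'), ‖G₁ t x - G₂ t x‖ₑ ^ 2) +
          ∑ i, ‖(∫ x in (Ω : Set E'), φ i x • v₁ t x) -
            ∫ x in (Ω : Set E'), φ i x • v₂ t x‖ₑ ^ 2 := by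
          simp only [mul_add, Pi.sub_apply]
  -- (2) integrate in time
  have hGt : ∫⁻ t in Ioo a b, ∫⁻ x in (Ω : Set E'), ‖G₁ t x - G₂ t x‖ₑ ^ 2 ≤ 4 * Cg := by
    change ∫⁻ t in Ioo a b, ∫⁻ x in (Ω : Set E'), ‖(uncurry G₁ - uncurry G₂) (t, x)‖ₑ ^ 2 ≤ 4 * Cg
    rw [← AubinLions.lintegral_sq_eq_lintegral_slice hgm]
    calc ∫⁻ z in Ioo a b ×ˢ (Ω : Set E'), ‖(uncurry G₁ - uncurry G₂) z‖ₑ ^ 2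
        ≤ ∫⁻ z in Ioo a b ×ˢ (Ω : Set E'), 2 * (‖G₁ z.1 z.2‖ₑ ^ 2 + ‖G₂ z.1 z.2‖ₑ ^ 2) :=
          lintegral_mono fun z => AubinLions.enorm_sub_sq_le _ _
      _ = 2 * ((∫⁻ z in Ioo a b ×ˢ (Ω : Set E'), ‖G₁ z.1 z.2‖ₑ ^ 2) +
            ∫⁻ z in Ioo a b ×ˢ (Ω : Set E'), ‖G₂ z.1 z.2‖ₑ ^ 2) := by
          have hG1m : AEMeasurable (fun z : ℝ × E' => ‖G₁ z.1 z.2‖ₑ ^ 2)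
              (volume.restrict (Ioo a b ×ˢ (Ω : Set E'))) := hGm₁.enorm.pow_const 2
          rw [lintegral_const_mul' _ _ ENNReal.ofNat_ne_top, lintegral_add_left' hG1m]
      _ ≤ 2 * (Cg + Cg) := mul_le_mul' le_rfl (add_le_add hGb₁ hGb₂)
      _ = 4 * Cg := by ring
  have hFm₁ : ∀ i, AEMeasurable (fun t => ‖(∫ x in (Ω : Set E'), φ i x • v₁ t x) - L i t‖ₑ ^ 2)
      (volume.restrict (Ioo a b)) := fun i => ((hPm₁ i).sub (hLm i)).enorm.pow_const 2
  have hPt : ∀ i, ∫⁻ t in Ioo a b,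
      ‖(∫ x in (Ω : Set E'), φ i x • v₁ t x) - ∫ x in (Ω : Set E'), φ i x • v₂ t x‖ₑ ^ 2 ≤
      2 * ((∫⁻ t in Ioo a b, ‖(∫ x in (Ω : Set E'), φ i x • v₁ t x) - L i t‖ₑ ^ 2) +
        ∫⁻ t in Ioo a b, ‖(∫ x in (Ω : Set E'), φ i x • v₂ t x) - L i t‖ₑ ^ 2) := by
    intro i
    calc ∫⁻ t in Ioo a b,
          ‖(∫ x in (Ω : Set E'), φ i x • v₁ t x) - ∫ x in (Ω : Set E'), φ i x • v₂ t x‖ₑ ^ 2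
        ≤ ∫⁻ t in Ioo a b, 2 * (‖(∫ x in (Ω : Set E'), φ i x • v₁ t x) - L i t‖ₑ ^ 2 +
            ‖(∫ x in (Ω : Set E'), φ i x • v₂ t x) - L i t‖ₑ ^ 2) := by
          refine lintegral_mono fun t => ?_
          have e : (∫ x in (Ω : Set E'), φ i x • v₁ t x) - ∫ x in (Ω : Set E'), φ i x • v₂ t x =
              ((∫ x in (Ω : Set E'), φ i x • v₁ t x) - L i t) -
                ((∫ x in (Ω : Set E'), φ i x • v₂ t x) - L i t) := by abel
          rw [e]
          exact AubinLions.enorm_sub_sq_le _ _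
      _ = _ := by
          rw [lintegral_const_mul' _ _ ENNReal.ofNat_ne_top, lintegral_add_left' (hFm₁ i)]
  have hSm : AEMeasurable (fun t => ∫⁻ x in (Ω : Set E'), ‖G₁ t x - G₂ t x‖ₑ ^ 2)
      (volume.restrict (Ioo a b)) := by
    have h := AubinLions.aemeasurable_lintegral_slice hgm
    simpa only [Pi.sub_apply, Function.uncurry_apply_pair] using h
  have hQm : ∀ i, AEMeasurable (fun t =>
      ‖(∫ x in (Ω : Set E'), φ i x • v₁ t x) - ∫ x in (Ω : Set E'), φ i x • v₂ t x‖ₑ ^ 2)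
      (volume.restrict (Ioo a b)) := fun i => ((hPm₁ i).sub (hPm₂ i)).enorm.pow_const 2
  have hQsm : AEMeasurable (fun t =>
      ∑ i, ‖(∫ x in (Ω : Set E'), φ i x • v₁ t x) - ∫ x in (Ω : Set E'), φ i x • v₂ t x‖ₑ ^ 2)
      (volume.restrict (Ioo a b)) := Finset.aemeasurable_fun_sum _ fun i _ => hQm i
  calc ∫⁻ z in Ioo a b ×ˢ (Ω : Set E'), ‖v₁ z.1 z.2 - v₂ z.1 z.2‖ₑ ^ 2
      = ∫⁻ t in Ioo a b, ∫⁻ x in (Ω : Set E'), ‖v₁ t x - v₂ t x‖ₑ ^ 2 :=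
        AubinLions.lintegral_sq_eq_lintegral_slice hwm
    _ ≤ ∫⁻ t in Ioo a b, (ε₁ * (4 * C) + ε₁ * (∫⁻ x in (Ω : Set E'), ‖G₁ t x - G₂ t x‖ₑ ^ 2) +
          ∑ i, ‖(∫ x in (Ω : Set E'), φ i x • v₁ t x) - ∫ x in (Ω : Set E'), φ i x • v₂ t x‖ₑ ^ 2) :=
        lintegral_mono_ae hineq
    _ = ε₁ * (4 * C) * volume (Ioo a b) +
          ε₁ * (∫⁻ t in Ioo a b, ∫⁻ x in (Ω : Set E'), ‖G₁ t x - G₂ t x‖ₑ ^ 2) +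
          ∑ i, ∫⁻ t in Ioo a b,
            ‖(∫ x in (Ω : Set E'), φ i x • v₁ t x) - ∫ x in (Ω : Set E'), φ i x • v₂ t x‖ₑ ^ 2 := by
        rw [lintegral_add_right' _ hQsm, lintegral_add_right' _ (hSm.const_mul _), lintegral_const,
          Measure.restrict_apply_univ, lintegral_const_mul'' _ hSm,
          lintegral_finsetSum' _ fun i _ => hQm i]
    _ ≤ ε₁ * (4 * C) * volume (Ioo a b) + ε₁ * (4 * Cg) +
          ∑ i, 2 * ((∫⁻ t in Ioo a b, ‖(∫ x in (Ω : Set E'), φ i x • v₁ t x) - L i t‖ₑ ^ 2) +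
            ∫⁻ t in Ioo a b, ‖(∫ x in (Ω : Set E'), φ i x • v₂ t x) - L i t‖ₑ ^ 2) := by
        gcongr with i
        exact hPt i
    _ = _ := by ring

/-- **The Cauchy estimate (Aubin–Lions à la Hopf–Temam).** Let `Ω` be a bounded Lipschitz domain,
`I = (a, b)`, and `v_k` jointly measurable fields on `I × Ω` with
* `∫_Ω ‖v_k(t)‖² ≤ C` for a.e. `t ∈ I` (uniform `L^∞_t L²_x` bound),
* slice-wise weak derivatives `G_k(t)` on `Ω` for a.e. `t`, jointly measurable, with
  `∫_I ∫_Ω ‖G_k‖² ≤ C_g` (uniform `L²_t H¹_x` bound),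
* for every real test function `φ` on `Ω`, convergence of the pairings `∫_Ω φ • v_k(t)` for a.e.
  `t ∈ I`.
Then `(v_k)` is a Cauchy sequence in `L²(I × Ω)`: `∫_I ∫_Ω ‖v_k - v_l‖² → 0` as `k, l → ∞`.
Proof: Ehrling's lemma (`ehrling`) on a.e. slice of `v_k - v_l`, integrated in time
(`AubinLions.lintegral_sub_sq_le`); the finitely many pairing terms tend to zero by dominated
convergence (Temam 1977/79, Ch. III, proof of Thm. 2.1; Lions 1969, Ch. 1, Thm. 5.1; the
`L^∞_t L²_x ∩ L²_t H¹_x` setting is that of Hopf 1951 and of the compactness of weak solutions of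
the Navier–Stokes equations, Lemarié-Rieusset 2016, Thm. 12.1). [cite: Temam1979, Ch. III §2 Thm. 2.1 (proof)] [cite: Lemarierieusset2016, Thm. 12.1 (Rellich–Lions)] -/
theorem AubinLions.tendsto_lintegral_sub_sq_atTop_prod {Ω : Opens E'} (hΩ : IsLipschitzDomain Ω)
    (hbΩ : IsBounded (Ω : Set E')) {a b : ℝ}
    {v : ℕ → ℝ → E' → F} {G : ℕ → ℝ → E' → E' →L[ℝ] F} {C Cg : ℝ≥0∞}
    (hC : C ≠ ⊤) (hCg : Cg ≠ ⊤)
    (hvm : ∀ k, AEStronglyMeasurable (uncurry (v k)) (volume.restrict (Ioo a b ×ˢ (Ω : Set E'))))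
    (hvE : ∀ k, ∀ᵐ t ∂(volume.restrict (Ioo a b)), ∫⁻ x in (Ω : Set E'), ‖v k t x‖ₑ ^ 2 ≤ C)
    (hGm : ∀ k, AEStronglyMeasurable (uncurry (G k)) (volume.restrict (Ioo a b ×ˢ (Ω : Set E'))))
    (hG : ∀ k, ∀ᵐ t ∂(volume.restrict (Ioo a b)), HasWeakFDerivOn Ω volume (v k t) (G k t))
    (hGb : ∀ k, ∫⁻ z in Ioo a b ×ˢ (Ω : Set E'), ‖G k z.1 z.2‖ₑ ^ 2 ≤ Cg)
    (hP : ∀ φ : E' → ℝ, IsTestFunctionOn Ω φ → ∃ L : ℝ → F, ∀ᵐ t ∂(volume.restrict (Ioo a b)),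
      Tendsto (fun k => ∫ x in (Ω : Set E'), φ x • v k t x) atTop (𝓝 (L t))) :
    Tendsto (fun kl : ℕ × ℕ => ∫⁻ z in Ioo a b ×ˢ (Ω : Set E'),
      ‖v kl.1 z.1 z.2 - v kl.2 z.1 z.2‖ₑ ^ 2) atTop (𝓝 0) := by
  have hIfin : volume (Ioo a b) ≠ ⊤ := measure_Ioo_lt_top.ne
  have hMt : 4 * C * volume (Ioo a b) + 4 * Cg ≠ ⊤ := ENNReal.add_ne_top.2
    ⟨ENNReal.mul_ne_top (ENNReal.mul_ne_top (by simp) hC) hIfin, ENNReal.mul_ne_top (by simp) hCg⟩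
  rw [ENNReal.tendsto_nhds_zero]
  intro ε hε
  have hε2 : ε / 2 ≠ 0 := (ENNReal.half_pos hε.ne').ne'
  obtain ⟨ε₁, hε₁, hε₁M⟩ := ENNReal.exists_nnreal_pos_mul_lt hMt hε2
  have hε₁0 : (ε₁ : ℝ≥0∞) ≠ 0 := by exact_mod_cast hε₁.ne'
  -- Ehrling's lemma at level `ε₁`
  obtain ⟨n, φ, hφ, hEhr⟩ := ehrling (F := F) hΩ hbΩ volume hε₁0
  -- the limits of the pairings, their measurability and their convergence in `L²(I)`
  choose L hL using fun i => hP (φ i) (hφ i)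
  have hφm : ∀ i, AEStronglyMeasurable (φ i) (volume.restrict (Ω : Set E')) := fun i =>
    (hφ i).contDiff.continuous.aestronglyMeasurable
  have hLm : ∀ i, AEStronglyMeasurable (L i) (volume.restrict (Ioo a b)) := fun i =>
    aestronglyMeasurable_of_tendsto_ae atTop
      (fun k => AubinLions.aestronglyMeasurable_integral_smul_slice (hvm k) (hφm i)) (hL i)
  have hDlim : ∀ i, Tendsto (fun k => ∫⁻ t in Ioo a b,
      ‖(∫ x in (Ω : Set E'), φ i x • v k t x) - L i t‖ₑ ^ 2) atTop (𝓝 0) := fun i =>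
    AubinLions.tendsto_lintegral_pairing_sub hC hvm hvE (hφ i) (hL i)
  have hT : Tendsto (fun kl : ℕ × ℕ => ∑ i, 2 *
      ((∫⁻ t in Ioo a b, ‖(∫ x in (Ω : Set E'), φ i x • v kl.1 t x) - L i t‖ₑ ^ 2) +
        ∫⁻ t in Ioo a b, ‖(∫ x in (Ω : Set E'), φ i x • v kl.2 t x) - L i t‖ₑ ^ 2)) atTop (𝓝 0) := by
    have h0 : (∑ _i : Fin n, 2 * ((0 : ℝ≥0∞) + 0)) = 0 := by simp
    rw [← h0]
    refine tendsto_finsetSum _ fun i _ => ENNReal.Tendsto.const_mul ?_ (Or.inr ENNReal.ofNat_ne_top)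
    have h1 : Tendsto (fun kl : ℕ × ℕ =>
        (∫⁻ t in Ioo a b, ‖(∫ x in (Ω : Set E'), φ i x • v kl.1 t x) - L i t‖ₑ ^ 2) +
          ∫⁻ t in Ioo a b, ‖(∫ x in (Ω : Set E'), φ i x • v kl.2 t x) - L i t‖ₑ ^ 2)
        ((atTop : Filter ℕ) ×ˢ (atTop : Filter ℕ)) (𝓝 (0 + 0)) :=
      ((hDlim i).comp tendsto_fst).add ((hDlim i).comp tendsto_snd)
    rw [prod_atTop_atTop_eq] at h1
    exact h1
  have hev := ENNReal.tendsto_nhds_zero.1 hT (ε / 2) (ENNReal.half_pos hε.ne')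
  filter_upwards [hev] with kl hkl
  calc ∫⁻ z in Ioo a b ×ˢ (Ω : Set E'), ‖v kl.1 z.1 z.2 - v kl.2 z.1 z.2‖ₑ ^ 2
      ≤ (ε₁ : ℝ≥0∞) * (4 * C * volume (Ioo a b) + 4 * Cg) + ∑ i, 2 *
          ((∫⁻ t in Ioo a b, ‖(∫ x in (Ω : Set E'), φ i x • v kl.1 t x) - L i t‖ₑ ^ 2) +
            ∫⁻ t in Ioo a b, ‖(∫ x in (Ω : Set E'), φ i x • v kl.2 t x) - L i t‖ₑ ^ 2) :=
        AubinLions.lintegral_sub_sq_le hbΩ hC (hvm _) (hvm _) (hvE _) (hvE _) (hGm _) (hGm _)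
          (hG _) (hG _) (hGb _) (hGb _) hφ hEhr hLm
    _ ≤ ε / 2 + ε / 2 := add_le_add hε₁M.le hkl
    _ = ε := ENNReal.add_halves ε

/-- **Strong `L²(I × Ω)` compactness from slice-wise weak convergence (Aubin–Lions à la
Hopf–Temam).** Let `Ω` be a bounded Lipschitz domain of a finite-dimensional real inner product
space (Lebesgue measure), `I = (a, b)`, `F` a finite-dimensional real normed space, and
`v_k : I × Ω → F` jointly measurable fields with
* `∫_Ω ‖v_k(t)‖² ≤ C` for a.e. `t ∈ I`, uniformly in `k` (`L^∞_t L²_x` bound);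
* for a.e. `t`, a weak derivative `G_k(t)` of the slice `v_k(t)` on `Ω` (`G_k` jointly
  measurable) with `∫_I ∫_Ω ‖G_k‖² ≤ C_g` uniformly in `k` (`L²_t H¹_x` bound);
* for every real test function `φ ∈ C_c^∞(Ω)`, convergence of the pairings `∫_Ω φ • v_k(t)` as
  `k → ∞` for a.e. `t ∈ I` (slice-wise convergence in `𝓓'(Ω)`, e.g. slice-wise weak `L²`
  convergence).
Then there is a jointly measurable field `u` on `I × Ω` with `∫_Ω ‖u(t)‖² ≤ C` for a.e. `t`
such that `v_k → u` **strongly** in `L²(I × Ω)` and the slice pairings of `v_k` converge to those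
of `u` for a.e. `t`. This is the compactness theorem of Aubin–Lions type in the form used for
weak solutions of the Navier–Stokes equations (Temam 1977/79, Ch. III, Thm. 2.1 with
`X₀ = H¹`, `X = L²`; Hopf 1951, §4; Lions 1969, Ch. 1, Thm. 5.1; Lemarié-Rieusset 2016, Thm. 12.1
"Rellich–Lions"; the hypothesis on the pairings replaces the bound on `∂ₜ v_k`, from which it
follows in the applications by Arzelà–Ascoli). Proof: the sequence is Cauchy in `L²(I × Ω)`
(`AubinLions.tendsto_lintegral_sub_sq_atTop_prod`), hence convergent (completeness of `L²`); the
slices of the limit are identified through a subsequence converging slice-wise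
(`AubinLions.exists_subseq_ae_tendsto_slice`). [cite: Temam1979, Ch. III §2 Thm. 2.1] [cite: Lemarierieusset2016, Thm. 12.1 (Rellich–Lions)] -/
theorem AubinLions.exists_strong_limit {Ω : Opens E'} (hΩ : IsLipschitzDomain Ω)
    (hbΩ : IsBounded (Ω : Set E')) {a b : ℝ}
    {v : ℕ → ℝ → E' → F} {G : ℕ → ℝ → E' → E' →L[ℝ] F} {C Cg : ℝ≥0∞}
    (hC : C ≠ ⊤) (hCg : Cg ≠ ⊤)
    (hvm : ∀ k, AEStronglyMeasurable (uncurry (v k)) (volume.restrict (Ioo a b ×ˢ (Ω : Set E'))))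
    (hvE : ∀ k, ∀ᵐ t ∂(volume.restrict (Ioo a b)), ∫⁻ x in (Ω : Set E'), ‖v k t x‖ₑ ^ 2 ≤ C)
    (hGm : ∀ k, AEStronglyMeasurable (uncurry (G k)) (volume.restrict (Ioo a b ×ˢ (Ω : Set E'))))
    (hG : ∀ k, ∀ᵐ t ∂(volume.restrict (Ioo a b)), HasWeakFDerivOn Ω volume (v k t) (G k t))
    (hGb : ∀ k, ∫⁻ z in Ioo a b ×ˢ (Ω : Set E'), ‖G k z.1 z.2‖ₑ ^ 2 ≤ Cg)
    (hP : ∀ φ : E' → ℝ, IsTestFunctionOn Ω φ → ∃ L : ℝ → F, ∀ᵐ t ∂(volume.restrict (Ioo a b)),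
      Tendsto (fun k => ∫ x in (Ω : Set E'), φ x • v k t x) atTop (𝓝 (L t))) :
    ∃ u : ℝ → E' → F,
      AEStronglyMeasurable (uncurry u) (volume.restrict (Ioo a b ×ˢ (Ω : Set E'))) ∧
      (∀ᵐ t ∂(volume.restrict (Ioo a b)), ∫⁻ x in (Ω : Set E'), ‖u t x‖ₑ ^ 2 ≤ C) ∧
      Tendsto (fun k => ∫⁻ z in Ioo a b ×ˢ (Ω : Set E'), ‖v k z.1 z.2 - u z.1 z.2‖ₑ ^ 2)
        atTop (𝓝 0) ∧
      ∀ φ : E' → ℝ, IsTestFunctionOn Ω φ → ∀ᵐ t ∂(volume.restrict (Ioo a b)),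
        Tendsto (fun k => ∫ x in (Ω : Set E'), φ x • v k t x) atTop
          (𝓝 (∫ x in (Ω : Set E'), φ x • u t x)) := by
  haveI : Fact ((1 : ℝ≥0∞) ≤ 2) := ⟨one_le_two⟩
  haveI : IsFiniteMeasure ((volume : Measure E').restrict (Ω : Set E')) := ⟨by
    rw [Measure.restrict_apply_univ]
    exact (measure_mono subset_closure).trans_lt hbΩ.isCompact_closure.measure_lt_top⟩
  have hIfin : volume (Ioo a b) ≠ ⊤ := measure_Ioo_lt_top.ne
  -- (1) the fields are in `L²(I × Ω)`
  have hv2 : ∀ k, ∫⁻ z in Ioo a b ×ˢ (Ω : Set E'), ‖uncurry (v k) z‖ₑ ^ 2 ≤ C * volume (Ioo a b) := by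
    intro k
    rw [AubinLions.lintegral_sq_eq_lintegral_slice (hvm k)]
    calc ∫⁻ t in Ioo a b, ∫⁻ x in (Ω : Set E'), ‖uncurry (v k) (t, x)‖ₑ ^ 2
        ≤ ∫⁻ _ in Ioo a b, C := lintegral_mono_ae (hvE k)
      _ = C * volume (Ioo a b) := by rw [lintegral_const, Measure.restrict_apply_univ]
  have hCI : C * volume (Ioo a b) < ⊤ := ENNReal.mul_lt_top hC.lt_top hIfin.lt_top
  have hvL2 : ∀ k, MemLp (uncurry (v k)) 2 (volume.restrict (Ioo a b ×ˢ (Ω : Set E'))) := by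
    intro k
    refine ⟨hvm k, ?_⟩
    rw [AubinLions.eLpNorm_two_eq_rpow]
    exact ENNReal.rpow_lt_top_of_nonneg (by norm_num) ((hv2 k).trans_lt hCI).ne
  -- (2) the Cauchy sequence in `L²(I × Ω)` and its limit
  set V : ℕ → Lp F 2 (volume.restrict (Ioo a b ×ˢ (Ω : Set E'))) :=
    fun k => (hvL2 k).toLp (uncurry (v k)) with hV
  have hVc : CauchySeq V := by
    rw [Lp.cauchySeq_Lp_iff_cauchySeq_eLpNorm]
    have hC2 := AubinLions.tendsto_lintegral_sub_sq_atTop_prod hΩ hbΩ hC hCg hvm hvE hGm hG hGb hP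
    have heq : ∀ kl : ℕ × ℕ, eLpNorm (⇑(V kl.1) - ⇑(V kl.2)) 2
        (volume.restrict (Ioo a b ×ˢ (Ω : Set E'))) =
        (∫⁻ z in Ioo a b ×ˢ (Ω : Set E'), ‖v kl.1 z.1 z.2 - v kl.2 z.1 z.2‖ₑ ^ 2) ^ (1 / 2 : ℝ) := by
      intro kl
      rw [eLpNorm_congr_ae (((hvL2 kl.1).coeFn_toLp).sub ((hvL2 kl.2).coeFn_toLp)),
        AubinLions.eLpNorm_two_eq_rpow]
      rfl
    simp_rw [heq]
    have h := ((ENNReal.continuous_rpow_const (y := (1 / 2 : ℝ))).tendsto (0 : ℝ≥0∞)).comp hC2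
    rw [ENNReal.zero_rpow_of_pos (by norm_num : (0 : ℝ) < 1 / 2)] at h
    exact h
  obtain ⟨U, hU⟩ := cauchySeq_tendsto_of_complete hVc
  have hUt : Tendsto (fun k => eLpNorm (⇑(V k) - ⇑U) 2 (volume.restrict (Ioo a b ×ˢ (Ω : Set E'))))
      atTop (𝓝 0) := (Lp.tendsto_Lp_iff_tendsto_eLpNorm' V U).1 hU
  -- (3) the limit field and the strong convergence
  have hum : AEStronglyMeasurable (uncurry fun t x => (U : ℝ × E' → F) (t, x))
      (volume.restrict (Ioo a b ×ˢ (Ω : Set E'))) := Lp.aestronglyMeasurable U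
  have hstrong : Tendsto (fun k => ∫⁻ z in Ioo a b ×ˢ (Ω : Set E'),
      ‖v k z.1 z.2 - (U : ℝ × E' → F) (z.1, z.2)‖ₑ ^ 2) atTop (𝓝 0) := by
    have h1 : ∀ k, ∫⁻ z in Ioo a b ×ˢ (Ω : Set E'), ‖v k z.1 z.2 - (U : ℝ × E' → F) (z.1, z.2)‖ₑ ^ 2 =
        eLpNorm (⇑(V k) - ⇑U) 2 (volume.restrict (Ioo a b ×ˢ (Ω : Set E'))) ^ 2 := by
      intro k
      rw [eLpNorm_congr_ae (((hvL2 k).coeFn_toLp).sub EventuallyEq.rfl), AubinLions.eLpNorm_two_sq]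
      rfl
    simp_rw [h1]
    have h := ENNReal.Tendsto.pow (n := 2) hUt
    rw [zero_pow two_ne_zero] at h
    exact h
  have hfin : ∀ k, ∫⁻ z in Ioo a b ×ˢ (Ω : Set E'),
      ‖uncurry (v k) z - uncurry (fun t x => (U : ℝ × E' → F) (t, x)) z‖ₑ ^ 2 ≠ ⊤ := by
    intro k
    have h := ((hvL2 k).sub (Lp.memLp U)).eLpNorm_lt_top
    rw [AubinLions.eLpNorm_two_eq_rpow] at h
    intro htop
    apply h.ne
    change (∫⁻ z in Ioo a b ×ˢ (Ω : Set E'),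
      ‖uncurry (v k) z - (U : ℝ × E' → F) z‖ₑ ^ 2) ^ (1 / 2 : ℝ) = ⊤
    have e : ∫⁻ z in Ioo a b ×ˢ (Ω : Set E'), ‖uncurry (v k) z - (U : ℝ × E' → F) z‖ₑ ^ 2 = ⊤ := htop
    rw [e, ENNReal.top_rpow_of_pos (by norm_num)]
  -- (4) slice convergence along a subsequence
  obtain ⟨σ, hσ, hslice⟩ := AubinLions.exists_subseq_ae_tendsto_slice
    (f := fun k => uncurry (v k)) (g := uncurry fun t x => (U : ℝ × E' → F) (t, x)) hvm hum hfin
    hstrong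
  -- measurability and square integrability of the slices
  have hvs : ∀ᵐ t ∂(volume.restrict (Ioo a b)), ∀ k,
      AEStronglyMeasurable (v k t) (volume.restrict (Ω : Set E')) :=
    ae_all_iff.2 fun k => AubinLions.ae_aestronglyMeasurable_slice (hvm k)
  have hus : ∀ᵐ t ∂(volume.restrict (Ioo a b)),
      AEStronglyMeasurable (fun x => (U : ℝ × E' → F) (t, x)) (volume.restrict (Ω : Set E')) :=
    AubinLions.ae_aestronglyMeasurable_slice hum
  have hvEall : ∀ᵐ t ∂(volume.restrict (Ioo a b)), ∀ k,
      ∫⁻ x in (Ω : Set E'), ‖v k t x‖ₑ ^ 2 ≤ C := ae_all_iff.2 hvE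
  -- (5) the slice bound of the limit
  have huE : ∀ᵐ t ∂(volume.restrict (Ioo a b)),
      ∫⁻ x in (Ω : Set E'), ‖(U : ℝ × E' → F) (t, x)‖ₑ ^ 2 ≤ C := by
    filter_upwards [hslice, hvs, hus, hvEall] with t ht hvt hut hEt
    -- `‖u(t)‖₂ ≤ ‖v_{σ j}(t)‖₂ + ‖v_{σ j}(t) - u(t)‖₂ ≤ C^{1/2} + δ_j`, `δ_j → 0`
    have hδ : Tendsto (fun j => (∫⁻ x in (Ω : Set E'),
        ‖v (σ j) t x - (U : ℝ × E' → F) (t, x)‖ₑ ^ 2) ^ (1 / 2 : ℝ)) atTop (𝓝 0) := by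
      have h := ((ENNReal.continuous_rpow_const (y := (1 / 2 : ℝ))).tendsto (0 : ℝ≥0∞)).comp ht
      rw [ENNReal.zero_rpow_of_pos (by norm_num : (0 : ℝ) < 1 / 2)] at h
      exact h
    have hbound : ∀ j, eLpNorm (fun x => (U : ℝ × E' → F) (t, x)) 2 (volume.restrict (Ω : Set E')) ≤
        C ^ (1 / 2 : ℝ) + (∫⁻ x in (Ω : Set E'),
          ‖v (σ j) t x - (U : ℝ × E' → F) (t, x)‖ₑ ^ 2) ^ (1 / 2 : ℝ) := by
      intro j
      have e : (fun x => (U : ℝ × E' → F) (t, x)) =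
          v (σ j) t + (fun x => (U : ℝ × E' → F) (t, x) - v (σ j) t x) := by
        funext x; simp
      calc eLpNorm (fun x => (U : ℝ × E' → F) (t, x)) 2 (volume.restrict (Ω : Set E'))
          = eLpNorm (v (σ j) t + fun x => (U : ℝ × E' → F) (t, x) - v (σ j) t x) 2
              (volume.restrict (Ω : Set E')) := by rw [← e]
        _ ≤ eLpNorm (v (σ j) t) 2 (volume.restrict (Ω : Set E')) +
            eLpNorm (fun x => (U : ℝ × E' → F) (t, x) - v (σ j) t x) 2
              (volume.restrict (Ω : Set E')) := eLpNorm_add_le (hvt _) (hut.sub (hvt _)) one_le_two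
        _ ≤ C ^ (1 / 2 : ℝ) + (∫⁻ x in (Ω : Set E'),
            ‖v (σ j) t x - (U : ℝ × E' → F) (t, x)‖ₑ ^ 2) ^ (1 / 2 : ℝ) := by
            gcongr
            · rw [AubinLions.eLpNorm_two_eq_rpow]
              exact ENNReal.rpow_le_rpow (hEt _) (by norm_num)
            · rw [AubinLions.eLpNorm_two_eq_rpow]
              refine le_of_eq (congrArg (fun z => z ^ (1 / 2 : ℝ)) (lintegral_congr fun x => ?_))
              rw [← enorm_neg, neg_sub]
    have hlim := ge_of_tendsto' (tendsto_const_nhds.add hδ) hbound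
    rw [add_zero] at hlim
    calc ∫⁻ x in (Ω : Set E'), ‖(U : ℝ × E' → F) (t, x)‖ₑ ^ 2
        = eLpNorm (fun x => (U : ℝ × E' → F) (t, x)) 2 (volume.restrict (Ω : Set E')) ^ 2 :=
          (AubinLions.eLpNorm_two_sq _ _).symm
      _ ≤ (C ^ (1 / 2 : ℝ)) ^ 2 := pow_le_pow_left' hlim 2
      _ = C := by rw [← ENNReal.rpow_natCast, ← ENNReal.rpow_mul]; norm_num
  -- (6) the pairings of the limit
  refine ⟨fun t x => (U : ℝ × E' → F) (t, x), hum, huE, hstrong, fun φ hφ => ?_⟩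
  obtain ⟨L, hL⟩ := hP φ hφ
  have hφ2 : MemLp φ 2 (volume.restrict (Ω : Set E')) :=
    (Ehrling.memLp_two_of_isTestFunctionOn hφ volume).restrict _
  filter_upwards [hL, hslice, hvs, hus, hvEall, huE] with t hLt ht hvt hut hEt hut2
  have hmv : ∀ k, MemLp (v k t) 2 (volume.restrict (Ω : Set E')) := fun k => by
    refine ⟨hvt k, ?_⟩
    rw [AubinLions.eLpNorm_two_eq_rpow]
    exact ENNReal.rpow_lt_top_of_nonneg (by norm_num) ((hEt k).trans_lt hC.lt_top).ne
  have hmu : MemLp (fun x => (U : ℝ × E' → F) (t, x)) 2 (volume.restrict (Ω : Set E')) := by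
    refine ⟨hut, ?_⟩
    rw [AubinLions.eLpNorm_two_eq_rpow]
    exact ENNReal.rpow_lt_top_of_nonneg (by norm_num) (hut2.trans_lt hC.lt_top).ne
  have hsub : Tendsto (fun j => ∫ x in (Ω : Set E'), φ x • v (σ j) t x) atTop
      (𝓝 (∫ x in (Ω : Set E'), φ x • (U : ℝ × E' → F) (t, x))) :=
    AubinLions.tendsto_integral_smul_of_tendsto_lintegral (w := fun j => v (σ j) t)
      (fun j => hvt _) hut hφ2 (fun j => Ehrling.integrable_smul_of_memLp_two hφ (hmv _))
      (Ehrling.integrable_smul_of_memLp_two hφ hmu) ht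
  have hsub' : Tendsto (fun j => ∫ x in (Ω : Set E'), φ x • v (σ j) t x) atTop (𝓝 (L t)) :=
    hLt.comp hσ.tendsto_atTop
  have e : L t = ∫ x in (Ω : Set E'), φ x • (U : ℝ × E' → F) (t, x) := tendsto_nhds_unique hsub' hsub
  rw [← e]
  exact hLt

/-- **Strong `L²(I × Ω)` convergence to a given slice-wise weak limit.** In the setting of
`AubinLions.exists_strong_limit`, if `u` is a jointly measurable field on `I × Ω` with slices in
`L²(Ω)` for a.e. `t` and the slice pairings of `v_k` converge to those of `u`
(`∫_Ω φ • v_k(t) → ∫_Ω φ • u(t)` for a.e. `t`, for every real test function `φ` on `Ω` — e.g.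
`v_k(t) ⇀ u(t)` weakly in `L²(Ω)` for a.e. `t`), then `v_k → u` strongly in `L²(I × Ω)`:
`∫_I ∫_Ω ‖v_k - u‖² → 0` (Temam 1977/79, Ch. III, Thm. 2.1; Lemarié-Rieusset 2016, Thm. 12.1; the
limit of `AubinLions.exists_strong_limit` is identified with `u` slice-wise by the separation
lemma `ae_eq_zero_of_forall_setIntegral_smul_seq_eq_zero`). [cite: Temam1979, Ch. III §2 Thm. 2.1] [cite: Lemarierieusset2016, Thm. 12.1 (Rellich–Lions)] -/
theorem AubinLions.tendsto_lintegral_sub_sq_of_slice_pairings {Ω : Opens E'}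
    (hΩ : IsLipschitzDomain Ω) (hbΩ : IsBounded (Ω : Set E')) {a b : ℝ}
    {v : ℕ → ℝ → E' → F} {G : ℕ → ℝ → E' → E' →L[ℝ] F} {u : ℝ → E' → F} {C Cg : ℝ≥0∞}
    (hC : C ≠ ⊤) (hCg : Cg ≠ ⊤)
    (hvm : ∀ k, AEStronglyMeasurable (uncurry (v k)) (volume.restrict (Ioo a b ×ˢ (Ω : Set E'))))
    (hvE : ∀ k, ∀ᵐ t ∂(volume.restrict (Ioo a b)), ∫⁻ x in (Ω : Set E'), ‖v k t x‖ₑ ^ 2 ≤ C)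
    (hGm : ∀ k, AEStronglyMeasurable (uncurry (G k)) (volume.restrict (Ioo a b ×ˢ (Ω : Set E'))))
    (hG : ∀ k, ∀ᵐ t ∂(volume.restrict (Ioo a b)), HasWeakFDerivOn Ω volume (v k t) (G k t))
    (hGb : ∀ k, ∫⁻ z in Ioo a b ×ˢ (Ω : Set E'), ‖G k z.1 z.2‖ₑ ^ 2 ≤ Cg)
    (hum : AEStronglyMeasurable (uncurry u) (volume.restrict (Ioo a b ×ˢ (Ω : Set E'))))
    (huE : ∀ᵐ t ∂(volume.restrict (Ioo a b)), ∫⁻ x in (Ω : Set E'), ‖u t x‖ₑ ^ 2 < ⊤)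
    (hP : ∀ φ : E' → ℝ, IsTestFunctionOn Ω φ → ∀ᵐ t ∂(volume.restrict (Ioo a b)),
      Tendsto (fun k => ∫ x in (Ω : Set E'), φ x • v k t x) atTop
        (𝓝 (∫ x in (Ω : Set E'), φ x • u t x))) :
    Tendsto (fun k => ∫⁻ z in Ioo a b ×ˢ (Ω : Set E'), ‖v k z.1 z.2 - u z.1 z.2‖ₑ ^ 2)
      atTop (𝓝 0) := by
  haveI : IsFiniteMeasure ((volume : Measure E').restrict (Ω : Set E')) := ⟨by
    rw [Measure.restrict_apply_univ]
    exact (measure_mono subset_closure).trans_lt hbΩ.isCompact_closure.measure_lt_top⟩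
  obtain ⟨w, hwm, hwE, hws, hwP⟩ := AubinLions.exists_strong_limit hΩ hbΩ hC hCg hvm hvE hGm hG hGb
    fun φ hφ => ⟨_, hP φ hφ⟩
  -- identification of the slices of `w` and `u` through a dense sequence of test functions
  obtain ⟨d, hd, hdense⟩ := exists_seq_isTestFunctionOn_dense Ω (volume : Measure E')
  have hpair : ∀ᵐ t ∂(volume.restrict (Ioo a b)), ∀ j,
      ∫ x in (Ω : Set E'), d j x • w t x = ∫ x in (Ω : Set E'), d j x • u t x := by
    rw [ae_all_iff]
    intro j
    filter_upwards [hwP (d j) (hd j), hP (d j) (hd j)] with t h1 h2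
    exact tendsto_nhds_unique h1 h2
  have hws' : ∀ᵐ t ∂(volume.restrict (Ioo a b)),
      AEStronglyMeasurable (w t) (volume.restrict (Ω : Set E')) :=
    AubinLions.ae_aestronglyMeasurable_slice hwm
  have hus' : ∀ᵐ t ∂(volume.restrict (Ioo a b)),
      AEStronglyMeasurable (u t) (volume.restrict (Ω : Set E')) :=
    AubinLions.ae_aestronglyMeasurable_slice hum
  have hae : ∀ᵐ t ∂(volume.restrict (Ioo a b)), ∀ᵐ x ∂(volume.restrict (Ω : Set E')),
      uncurry w (t, x) = uncurry u (t, x) := by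
    filter_upwards [hpair, hws', hus', hwE, huE] with t hpt hwt hut hwEt huEt
    have hmw : MemLp (w t) 2 (volume.restrict (Ω : Set E')) := by
      refine ⟨hwt, ?_⟩
      rw [AubinLions.eLpNorm_two_eq_rpow]
      exact ENNReal.rpow_lt_top_of_nonneg (by norm_num) (hwEt.trans_lt hC.lt_top).ne
    have hmu : MemLp (u t) 2 (volume.restrict (Ω : Set E')) := by
      refine ⟨hut, ?_⟩
      rw [AubinLions.eLpNorm_two_eq_rpow]
      exact ENNReal.rpow_lt_top_of_nonneg (by norm_num) huEt.ne
    have h0 : ∀ j, ∫ x in (Ω : Set E'), d j x • (w t - u t) x = 0 := by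
      intro j
      have e : (fun x => d j x • (w t - u t) x) = fun x => d j x • w t x - d j x • u t x := by
        funext x; simp only [Pi.sub_apply, smul_sub]
      rw [e, integral_sub (Ehrling.integrable_smul_of_memLp_two (hd j) hmw)
        (Ehrling.integrable_smul_of_memLp_two (hd j) hmu), hpt j, sub_self]
    have hz := ae_eq_zero_of_forall_setIntegral_smul_seq_eq_zero hd hdense (hmw.sub hmu) h0
    filter_upwards [hz] with x hx
    simpa [sub_eq_zero] using hx
  have heq : uncurry w =ᵐ[volume.restrict (Ioo a b ×ˢ (Ω : Set E'))] uncurry u :=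
    AubinLions.ae_eq_of_ae_ae_slice hwm hum hae
  refine hws.congr' (Eventually.of_forall fun k => lintegral_congr_ae ?_)
  filter_upwards [heq] with z hz
  have e : w z.1 z.2 = u z.1 z.2 := hz
  rw [e]

end Main

end Literature.Analysis.FunctionSpaces
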